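import Summits.QuantumFields.BalabanUV.Beta.D1BFx.GramWeightSecondVariation
import Summits.QuantumFields.BalabanUV.Beta.D1BFx.SliceTransferJets

/-!
# `BalabanUV.Beta.D1BFx.GramWeightJets` — road «BF-x» for binder row D1, slot (K), X₃(ii) ROUTE T, brick **K-TA4G «GRAM FORM OF THE JET
# IDENTITY»** (`HOME/b2b-balaban-beta-d1-p2/K-ASSEMBLY-SPEC-v2.md` v2.1 §2, shape (R2) «canonical co-frame», owner ruling ρ-g6-5), PART 2b —
# THE JET LEVEL (one direction): from BARE 2-jets `(K, Q, τ′, A, W)` satisfying ONLY the algebraic Ward relations,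
# `secondVar M + secondVar Φ = secondVar N + 2·secondVar (τW)` with the weight jets `B := gram τ′ A` and the FP Gram jets `Φ := gram W B`,
# and the split `secondVar Φ = 2·secondVar (τ′W) + secondVar A`

HONEST DEPENDENCY (cell records, verbatim): «continuum YM on T⁴ ⇐ BetaPertH ∧ nine spine estimates (0/9 proved); BetaPertH ⇐ (D1) ∧ (D4) ∧
CAP+tail; G-an2-4 gates asym, D1 and NE2/3/4.»  HONEST FRAMING (cell contract, verbatim): «discharging `BetaPertH` makes Bałaban's UV stability
UNCONDITIONAL — a real constructive-QFT result; it is NOT the continuum limit and NOT the Clay problem.»  THIS MODULE DISCHARGES NOTHING of (K),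
of D1 or of the wall: [folklore] finite-dimensional calculus ∕ algebra over PART 2a `GramWeightSecondVariation` (`secondVar_gramTransfer`,
`secondVar_gram_split`), PART 1 `GramWeightDeterminant` (`det_gram_coframe`), and the road owner's model chain `SliceTransferJets` (the Taylor
curves `pc`∕`lc`, the exactly invariant dressed curves `Kc`∕`Qc` with `Kc_jets`∕`Qc_jets`∕`Kc_mul_wT`∕`Kc_transpose_mul_wT`∕`Qc_mul_wT`),
`SliceTransferJetsAlgebra` (`sJ`∕`wT`, `tau_wT₀₁₂`, `secondVar_inv_jets`, `secondVar_one`), `SliceTransferModel` (`HasDerivAt` suppliers),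
`LogDetSecondVariation` (`secondVar`) — all BY NAME.  [our object] data definitions: the Gram jet polynomials `gram₀∕gram₁∕gram₂` and the Gram
curve `gc`∕`gc₁` (plain abbreviations of product-rule expressions, asserting nothing).  No `def … : Prop`, nothing cited, no wall binder
instantiated, 0 sorry.  NOT D1, NOT BetaPertH, NOT continuum, NOT Clay.

ABSOLUTE RULE (cell charter, verbatim): «No internally-minted statement may enter as a cited fact. Every hypothesis is either kernel-proved in this
package or a verbatim quotation of a PUBLISHED theorem with page reference. The manuscript(s) under audit are NOT citable for their own disputed
steps — they are the thing under adjudication; programme-internal (2001/route/tribunal) claims are never citable.»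

CONTENT:
* §1 [our object] `gram₀ W B := WᵀBW`, `gram₁`, `gram₂` (first ∕ second Gram jets AS THE PRODUCT RULE DELIVERS THEM; the same polynomials give the
  co-frame WEIGHT jets `gram_i τ′ A` and the FP GRAM jets `gram_i W B`); the Gram curve `gc W B` of two Taylor curves with `hasDerivAt_gc`,
  `hasDerivAt_gc₁`, `of_gc_zero`, `of_gc₁_zero`, `of_gc` (= PART 2a's factorisation hypothesis, by `rfl`).
* §2 [folklore] RE-PARAMETRISATION of the gauge basis inside the Gram: `gram_i (W·S-jets) B = gram_i S (gram W B)` (`i = 0,1,2`; `abel`).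
* §3 [folklore] **`secondVar_sandwich`**: `secondVar (SᵀΦS; gram-jets) = secondVar Φ + 2·secondVar S` (PART 2a's split at `τ′ ≡ 1`).
* §4 [folklore] **`secondVar_gramTransfer_jets`** — THE IDENTITY FROM BARE 2-JETS (Ward relations for `K`, `Kᵀ`, `Q`; `det(τW₀)`, `det(τ′₀W₀)`,
  `det A₀`, `det M ≠ 0`; NO relation on the weight): PART 2a on `Kc`, `Qc`, `pc wT`, `gc τ′ A`, then §2–§3 + `secondVar_inv_jets` convert the
  re-parametrised FP Gram back (`W̃ = W·(τW)⁻¹`); **`secondVar_gram_split_jets`**.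
NOT HERE (PART 2c, next file): the 2-parameter (polarised, `mixedVar`) form and the `hessT` read-out printed in v2.0.
Provenance: G-an2-4 formalisation swarm leaf seat `b2b-balaban-gan24-formalise-leaf-03` gen 44 (cross-lane), claim «K-TA4G» PART 2b, 2026-08-20.
-/

noncomputable section

namespace Summit.QuantumFields.BalabanUV.Beta.D1BFx.GramWeightJets

open Matrix Filter Topology
open Literature.MathematicalPhysics.QuantumFieldTheory.Balaban1983to89.Beta.Composition (kkt)
open Literature.Analysis.Calculus (eventually_det_ne_zero)
open Summit.QuantumFields.BalabanUV.Beta.D1BFx.LogDetSecondVariation (secondVar)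
open Summit.QuantumFields.BalabanUV.Beta.D1BFx.SliceTransferModel (hasDerivAt_matMul hasDerivAt_transpose_mul hasDerivAt_matAdd)
open Summit.QuantumFields.BalabanUV.Beta.D1BFx.SliceTransferJetsAlgebra (sJ₀ sJ₁ sJ₂ wT₀ wT₁ wT₂ tau_wT₀ tau_wT₁ tau_wT₂
  secondVar_inv_jets secondVar_one)
open Summit.QuantumFields.BalabanUV.Beta.D1BFx.SliceTransferJets (pc lc of_pc of_lc of_pc_zero of_lc_zero hasDerivAt_pc hasDerivAt_lc
  Kc Kc₁ Kc₂ Qc Qc₁ Qc₂ hasDerivAt_Kc hasDerivAt_Kc₁ hasDerivAt_Qc hasDerivAt_Qc₁ Kc_jets Qc_jets Kc_mul_wT Kc_transpose_mul_wT Qc_mul_wT)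
open Summit.QuantumFields.BalabanUV.Beta.D1BFx.GramWeightSecondVariation (secondVar_gramTransfer secondVar_gram_split)

/-! ## §1 The Gram jet polynomials and the Gram curve of two Taylor curves -/

section Gram

variable {ι κ : Type*} [Fintype ι] [Fintype κ]

/-- [our object] Zeroth Gram jet `Wᵀ·B·W` (for `W : ι×κ`, `B : ι×ι`; used both for the FP Gram `WᵀBW` and for the co-frame weight `τ′ᵀAτ′`). -/
def gram₀ (W₀ : Matrix ι κ ℝ) (B₀ : Matrix ι ι ℝ) : Matrix κ κ ℝ := W₀ᵀ * B₀ * W₀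

/-- [our object] First Gram jet, as the product rule delivers it: `(W₁ᵀB₀ + W₀ᵀB₁)W₀ + W₀ᵀB₀W₁`. -/
def gram₁ (W₀ W₁ : Matrix ι κ ℝ) (B₀ B₁ : Matrix ι ι ℝ) : Matrix κ κ ℝ := (W₁ᵀ * B₀ + W₀ᵀ * B₁) * W₀ + W₀ᵀ * B₀ * W₁

/-- [our object] Second Gram jet, as the product rule delivers it. -/
def gram₂ (W₀ W₁ W₂ : Matrix ι κ ℝ) (B₀ B₁ B₂ : Matrix ι ι ℝ) : Matrix κ κ ℝ :=
  (W₂ᵀ * B₀ + W₁ᵀ * B₁ + (W₁ᵀ * B₁ + W₀ᵀ * B₂)) * W₀ + (W₁ᵀ * B₀ + W₀ᵀ * B₁) * W₁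
    + ((W₁ᵀ * B₀ + W₀ᵀ * B₁) * W₁ + W₀ᵀ * B₀ * W₂)

variable (W₀ W₁ W₂ : Matrix ι κ ℝ) (B₀ B₁ B₂ : Matrix ι ι ℝ)

/-- [our object] THE GRAM CURVE of the two Taylor curves: `u ↦ W(u)ᵀ·B(u)·W(u)`. -/
def gc : ℝ → κ → κ → ℝ := fun u =>
  Matrix.of.symm ((Matrix.of (pc W₀ W₁ W₂ u))ᵀ * Matrix.of (pc B₀ B₁ B₂ u) * Matrix.of (pc W₀ W₁ W₂ u))

/-- [our object] Its derivative curve (product rule). -/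
def gc₁ : ℝ → κ → κ → ℝ := fun u =>
  Matrix.of.symm (((Matrix.of (lc W₁ W₂ u))ᵀ * Matrix.of (pc B₀ B₁ B₂ u) + (Matrix.of (pc W₀ W₁ W₂ u))ᵀ * Matrix.of (lc B₁ B₂ u))
      * Matrix.of (pc W₀ W₁ W₂ u)
    + (Matrix.of (pc W₀ W₁ W₂ u))ᵀ * Matrix.of (pc B₀ B₁ B₂ u) * Matrix.of (lc W₁ W₂ u))

/-- [folklore] `gc′ = gc₁` everywhere. -/
theorem hasDerivAt_gc (u : ℝ) : HasDerivAt (gc W₀ W₁ W₂ B₀ B₁ B₂) (gc₁ W₀ W₁ W₂ B₀ B₁ B₂ u) u :=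
  hasDerivAt_matMul (hasDerivAt_transpose_mul (hasDerivAt_pc W₀ W₁ W₂ u) (hasDerivAt_pc B₀ B₁ B₂ u)) (hasDerivAt_pc W₀ W₁ W₂ u)

/-- [folklore] `gc″(0) = gram₂`. -/
theorem hasDerivAt_gc₁ : HasDerivAt (gc₁ W₀ W₁ W₂ B₀ B₁ B₂) (Matrix.of.symm (gram₂ W₀ W₁ W₂ B₀ B₁ B₂)) 0 := by
  have hW := hasDerivAt_pc W₀ W₁ W₂ (0 : ℝ)
  have hW' := hasDerivAt_lc W₁ W₂ (0 : ℝ)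
  have hB := hasDerivAt_pc B₀ B₁ B₂ (0 : ℝ)
  have hB' := hasDerivAt_lc B₁ B₂ (0 : ℝ)
  have h := hasDerivAt_matAdd
    (hasDerivAt_matMul (hasDerivAt_matAdd (hasDerivAt_transpose_mul hW' hB) (hasDerivAt_transpose_mul hW hB')) hW)
    (hasDerivAt_matMul (hasDerivAt_transpose_mul hW hB) hW')
  refine h.congr_deriv ?_
  have h0 : (0 : ℝ) ^ 2 / 2 = 0 := by norm_num
  simp only [of_pc, of_lc, h0, zero_smul, add_zero, Equiv.apply_symm_apply, gram₂]

omit [Fintype κ] in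
/-- [folklore] `gc(0) = gram₀`. -/
theorem of_gc_zero : Matrix.of (gc W₀ W₁ W₂ B₀ B₁ B₂ 0) = gram₀ W₀ B₀ := by
  show (Matrix.of (pc W₀ W₁ W₂ 0))ᵀ * Matrix.of (pc B₀ B₁ B₂ 0) * Matrix.of (pc W₀ W₁ W₂ 0) = gram₀ W₀ B₀
  rw [of_pc_zero, of_pc_zero, gram₀]

omit [Fintype κ] in
/-- [folklore] `gc′(0) = gram₁`. -/
theorem of_gc₁_zero : Matrix.of (gc₁ W₀ W₁ W₂ B₀ B₁ B₂ 0) = gram₁ W₀ W₁ B₀ B₁ := by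
  show ((Matrix.of (lc W₁ W₂ 0))ᵀ * Matrix.of (pc B₀ B₁ B₂ 0) + (Matrix.of (pc W₀ W₁ W₂ 0))ᵀ * Matrix.of (lc B₁ B₂ 0))
      * Matrix.of (pc W₀ W₁ W₂ 0) + (Matrix.of (pc W₀ W₁ W₂ 0))ᵀ * Matrix.of (pc B₀ B₁ B₂ 0) * Matrix.of (lc W₁ W₂ 0) = gram₁ W₀ W₁ B₀ B₁
  rw [of_pc_zero, of_pc_zero, of_lc_zero, of_lc_zero, gram₁]

omit [Fintype κ] in
/-- [folklore] The Gram curve IS the conjugation of the `B`-curve by the `W`-curve (the factorisation hypothesis of PART 2a, by `rfl`). -/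
theorem of_gc (u : ℝ) : Matrix.of (gc W₀ W₁ W₂ B₀ B₁ B₂ u)
    = (Matrix.of (pc W₀ W₁ W₂ u))ᵀ * Matrix.of (pc B₀ B₁ B₂ u) * Matrix.of (pc W₀ W₁ W₂ u) := rfl

end Gram

/-! ## §2 Re-parametrising the gauge basis inside the Gram: `W ↦ W·S` -/

section Reparam

variable {ι κ : Type*} [Fintype ι] [Fintype κ]
variable (W₀ W₁ W₂ : Matrix ι κ ℝ) (B₀ B₁ B₂ : Matrix ι ι ℝ) (S₀ S₁ S₂ : Matrix κ κ ℝ)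

/-- [folklore] Zeroth jets: `(W₀S₀)ᵀB₀(W₀S₀) = S₀ᵀ(W₀ᵀB₀W₀)S₀`. -/
theorem gram₀_reparam : gram₀ (W₀ * S₀) B₀ = gram₀ S₀ (gram₀ W₀ B₀) := by
  simp only [gram₀, Matrix.transpose_mul, Matrix.mul_assoc]

/-- [folklore] First jets: the Gram jet of the re-parametrised basis `(W₀S₀, W₁S₀ + W₀S₁)` is the `S`-sandwich jet of the Gram jets. -/
theorem gram₁_reparam :
    gram₁ (W₀ * S₀) (W₁ * S₀ + W₀ * S₁) B₀ B₁ = gram₁ S₀ S₁ (gram₀ W₀ B₀) (gram₁ W₀ W₁ B₀ B₁) := by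
  simp only [gram₀, gram₁, Matrix.transpose_mul, Matrix.transpose_add, Matrix.add_mul, Matrix.mul_add, Matrix.mul_assoc]
  abel

/-- [folklore] Second jets: the same for `(W₀S₀, W₁S₀ + W₀S₁, W₂S₀ + 2·W₁S₁ + W₀S₂)`. -/
theorem gram₂_reparam :
    gram₂ (W₀ * S₀) (W₁ * S₀ + W₀ * S₁) (W₂ * S₀ + (2 : ℝ) • (W₁ * S₁) + W₀ * S₂) B₀ B₁ B₂
      = gram₂ S₀ S₁ S₂ (gram₀ W₀ B₀) (gram₁ W₀ W₁ B₀ B₁) (gram₂ W₀ W₁ W₂ B₀ B₁ B₂) := by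
  simp only [gram₀, gram₁, gram₂, Matrix.transpose_mul, Matrix.transpose_add, Matrix.add_mul, Matrix.mul_add, Matrix.mul_assoc, two_smul]
  abel

end Reparam

/-! ## §3 The sandwich: `secondVar (SᵀΦS) = secondVar Φ + 2·secondVar S` -/

section Sandwich

variable {κ : Type*} [Fintype κ] [DecidableEq κ]

/-- [folklore] **`secondVar` OF A CONGRUENCE SANDWICH**: for 2-jets `Φ`, `S` with `Φ₀`, `S₀` invertible,
`secondVar (S₀ᵀΦ₀S₀) (gram₁ S Φ) (gram₂ S Φ) = secondVar Φ + 2·secondVar S` — PART 2a's Gram split at the constant co-frame `τ′ ≡ 1`. -/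
theorem secondVar_sandwich (Φ₀ Φ₁ Φ₂ S₀ S₁ S₂ : Matrix κ κ ℝ) (hΦ : Φ₀.det ≠ 0) (hS : S₀.det ≠ 0) :
    secondVar (gram₀ S₀ Φ₀) (gram₁ S₀ S₁ Φ₀ Φ₁) (gram₂ S₀ S₁ S₂ Φ₀ Φ₁ Φ₂) = secondVar Φ₀ Φ₁ Φ₂ + 2 * secondVar S₀ S₁ S₂ := by
  have hT0 : (Matrix.of (pc (1 : Matrix κ κ ℝ) 0 0 0) * Matrix.of (pc S₀ S₁ S₂ 0)).det ≠ 0 := by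
    rw [of_pc_zero, of_pc_zero, Matrix.one_mul]; exact hS
  have hA0 : (Matrix.of (pc Φ₀ Φ₁ Φ₂ 0)).det ≠ 0 := by rw [of_pc_zero]; exact hΦ
  have h := secondVar_gram_split
    (B := pc Φ₀ Φ₁ Φ₂) (B₁ := lc Φ₁ Φ₂) (B₂ := Φ₂) (W := pc S₀ S₁ S₂) (W₁ := lc S₁ S₂) (W₂ := S₂)
    (T := pc (1 : Matrix κ κ ℝ) 0 0) (T₁ := lc (0 : Matrix κ κ ℝ) 0) (T₂ := (0 : Matrix κ κ ℝ))
    (A := pc Φ₀ Φ₁ Φ₂) (A₁ := lc Φ₁ Φ₂) (A₂ := Φ₂)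
    (Eventually.of_forall fun u => hasDerivAt_pc Φ₀ Φ₁ Φ₂ u) (hasDerivAt_lc Φ₁ Φ₂ 0)
    (Eventually.of_forall fun u => hasDerivAt_pc S₀ S₁ S₂ u) (hasDerivAt_lc S₁ S₂ 0)
    (Eventually.of_forall fun u => hasDerivAt_pc (1 : Matrix κ κ ℝ) 0 0 u) (hasDerivAt_lc (0 : Matrix κ κ ℝ) 0 0)
    (Eventually.of_forall fun u => hasDerivAt_pc Φ₀ Φ₁ Φ₂ u) (hasDerivAt_lc Φ₁ Φ₂ 0)
    (Eventually.of_forall fun u => by simp only [of_pc, smul_zero, add_zero, Matrix.transpose_one, Matrix.one_mul, Matrix.mul_one])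
    hT0 hA0
  simp only [of_pc_zero, of_lc_zero, Matrix.one_mul, Matrix.zero_mul, zero_add] at h
  rw [gram₀, gram₁, gram₂]
  linarith

end Sandwich


/-! ## §4 THE GRAM-FORM SLICE-TRANSFER IDENTITY FROM BARE 2-JETS (shape (R2): co-frame jets `τ′`, `A` free) -/

section Main

variable {ν μ ρ : Type*} [Fintype ν] [Fintype μ] [Fintype ρ] [DecidableEq ν] [DecidableEq μ] [DecidableEq ρ]

omit [DecidableEq ν] in
/-- [folklore] The zeroth FP Gram of a co-frame weight is invertible: `det(Wᵀ(τ′ᵀAτ′)W) = det(τ′W)²·det A ≠ 0`. -/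
theorem det_gram₀_gram₀_ne_zero (T₀ : Matrix ρ ν ℝ) (A₀ : Matrix ρ ρ ℝ) (W₀ : Matrix ν ρ ℝ) (hT : (T₀ * W₀).det ≠ 0)
    (hA : A₀.det ≠ 0) : (gram₀ W₀ (gram₀ T₀ A₀)).det ≠ 0 := by
  rw [gram₀, gram₀, GramWeightDeterminant.det_gram_coframe]
  exact mul_ne_zero (pow_ne_zero 2 hT) hA

/-- [folklore] **K-TA4G AT MODEL LEVEL, JET FORM (shape (R2) «canonical co-frame»).**  Bare 2-jets `(K₀,K₁,K₂)` (form), `(Q₀,Q₁,Q₂)`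
(constraint), `(τ′₀,τ′₁,τ′₂)` (co-frame, `ρ×ν`), `(A₀,A₁,A₂)` (`ρ×ρ`), `(W₀,W₁,W₂)` (gauge basis), constant comb rows `τ`; hypotheses = ONLY the
algebraic Ward relations of `SliceTransferJets.secondVar_sliceTransfer_jets` (both sides for `K`, one for `Q`) and `det(τW₀)`, `det(τ′₀W₀)`,
`det A₀`, `det kkt K₀ [Q₀; τ] ≠ 0` — NO relation on the weight.  With the WEIGHT JETS `B_i := gram_i τ′ A` (product rule of `τ′ᵀAτ′`) and the
FP GRAM JETS `Φ_i := gram_i W B`:  `secondVar M + secondVar Φ = secondVar N + 2·secondVar (τW)`, `N`-jets `kkt (K_i + B_i) Q_i`.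
(Derived from PART 2a on the exactly invariant dressed curves `Kc`, `Qc`, `pc wT` of `SliceTransferJets` and the Gram curve `gc τ′ A`; the
re-parametrised FP Gram is converted back by §2–§3 and `secondVar_inv_jets`.) -/
theorem secondVar_gramTransfer_jets (K₀ K₁ K₂ : Matrix ν ν ℝ) (Q₀ Q₁ Q₂ : Matrix μ ν ℝ) (T₀ T₁ T₂ : Matrix ρ ν ℝ)
    (A₀ A₁ A₂ : Matrix ρ ρ ℝ) (W₀ W₁ W₂ : Matrix ν ρ ℝ) (τ : Matrix ρ ν ℝ)
    (a0 : K₀ * W₀ = 0) (a0t : K₀ᵀ * W₀ = 0) (a1 : K₁ * W₀ + K₀ * W₁ = 0) (a1t : K₁ᵀ * W₀ + K₀ᵀ * W₁ = 0)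
    (a2 : K₂ * W₀ + (2 : ℝ) • (K₁ * W₁) + K₀ * W₂ = 0) (a2t : K₂ᵀ * W₀ + (2 : ℝ) • (K₁ᵀ * W₁) + K₀ᵀ * W₂ = 0)
    (b0 : Q₀ * W₀ = 0) (b1 : Q₁ * W₀ + Q₀ * W₁ = 0) (b2 : Q₂ * W₀ + (2 : ℝ) • (Q₁ * W₁) + Q₀ * W₂ = 0)
    (hτ : (τ * W₀).det ≠ 0) (hT : (T₀ * W₀).det ≠ 0) (hA : A₀.det ≠ 0) (hM : (kkt K₀ (fromRows Q₀ τ)).det ≠ 0) :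
    secondVar (kkt K₀ (fromRows Q₀ τ)) (kkt K₁ (fromRows Q₁ (0 : Matrix ρ ν ℝ))) (kkt K₂ (fromRows Q₂ (0 : Matrix ρ ν ℝ)))
      + secondVar (gram₀ W₀ (gram₀ T₀ A₀)) (gram₁ W₀ W₁ (gram₀ T₀ A₀) (gram₁ T₀ T₁ A₀ A₁))
          (gram₂ W₀ W₁ W₂ (gram₀ T₀ A₀) (gram₁ T₀ T₁ A₀ A₁) (gram₂ T₀ T₁ T₂ A₀ A₁ A₂))
    = secondVar (kkt (K₀ + gram₀ T₀ A₀) Q₀) (kkt (K₁ + gram₁ T₀ T₁ A₀ A₁) Q₁) (kkt (K₂ + gram₂ T₀ T₁ T₂ A₀ A₁ A₂) Q₂)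
      + 2 * secondVar (τ * W₀) (τ * W₁) (τ * W₂) := by
  obtain ⟨hK0, hK1, hK2⟩ := Kc_jets (τ := τ) a0 a0t a1 a1t a2 a2t
  obtain ⟨hQ0, hQ1, hQ2⟩ := Qc_jets (τ := τ) b0 b1 b2
  have hS0 : (sJ₀ τ W₀).det ≠ 0 := (Matrix.isUnit_nonsing_inv_det _ (isUnit_iff_ne_zero.2 hτ)).ne_zero
  have hΦ0 : (gram₀ W₀ (gram₀ T₀ A₀)).det ≠ 0 := det_gram₀_gram₀_ne_zero T₀ A₀ W₀ hT hA
  -- nondegeneracy of the dressed data at 0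
  have hτW : (τ * Matrix.of (pc (wT₀ τ W₀) (wT₁ τ W₀ W₁) (wT₂ τ W₀ W₁ W₂) 0)).det ≠ 0 := by
    rw [of_pc_zero, tau_wT₀ τ W₀ hτ, Matrix.det_one]; exact one_ne_zero
  have hM' : (kkt (Matrix.of (Kc K₀ K₁ K₂ τ W₀ W₁ W₂ 0)) (fromRows (Matrix.of (Qc Q₀ Q₁ Q₂ τ W₀ W₁ W₂ 0)) τ)).det ≠ 0 := by
    rw [hK0, hQ0]; exact hM
  -- eventual invertibility of `τ′̃·W̃` and `Ã` near 0
  have hTW0 : (Matrix.of (Matrix.of.symm (Matrix.of (pc T₀ T₁ T₂ 0) * Matrix.of (pc (wT₀ τ W₀) (wT₁ τ W₀ W₁) (wT₂ τ W₀ W₁ W₂) 0)))).det ≠ 0 := by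
    show (Matrix.of (pc T₀ T₁ T₂ 0) * Matrix.of (pc (wT₀ τ W₀) (wT₁ τ W₀ W₁) (wT₂ τ W₀ W₁ W₂) 0)).det ≠ 0
    rw [of_pc_zero, of_pc_zero]
    show (T₀ * (W₀ * sJ₀ τ W₀)).det ≠ 0
    rw [← Matrix.mul_assoc, Matrix.det_mul]; exact mul_ne_zero hT hS0
  have hTWev : ∀ᶠ u in 𝓝 (0 : ℝ), (Matrix.of (pc T₀ T₁ T₂ u) * Matrix.of (pc (wT₀ τ W₀) (wT₁ τ W₀ W₁) (wT₂ τ W₀ W₁ W₂) u)).det ≠ 0 :=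
    eventually_det_ne_zero (hasDerivAt_matMul (hasDerivAt_pc T₀ T₁ T₂ 0)
      (hasDerivAt_pc (wT₀ τ W₀) (wT₁ τ W₀ W₁) (wT₂ τ W₀ W₁ W₂) 0)).hasFDerivAt hTW0
  have hA0' : (Matrix.of (pc A₀ A₁ A₂ 0)).det ≠ 0 := by rw [of_pc_zero]; exact hA
  have hAev : ∀ᶠ u in 𝓝 (0 : ℝ), (Matrix.of (pc A₀ A₁ A₂ u)).det ≠ 0 :=
    eventually_det_ne_zero (hasDerivAt_pc A₀ A₁ A₂ 0).hasFDerivAt hA0'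
  -- PART 2a on the dressed curves, the weight being the Gram curve of the co-frame Taylor curves
  have h := secondVar_gramTransfer τ
    (K := Kc K₀ K₁ K₂ τ W₀ W₁ W₂) (K₁ := Kc₁ K₀ K₁ K₂ τ W₀ W₁ W₂) (K₂ := Kc₂ K₀ K₁ K₂ τ W₀ W₁ W₂)
    (Q := Qc Q₀ Q₁ Q₂ τ W₀ W₁ W₂) (Q₁ := Qc₁ Q₀ Q₁ Q₂ τ W₀ W₁ W₂) (Q₂ := Qc₂ Q₀ Q₁ Q₂ τ W₀ W₁ W₂)
    (B := gc T₀ T₁ T₂ A₀ A₁ A₂) (B₁ := gc₁ T₀ T₁ T₂ A₀ A₁ A₂) (B₂ := gram₂ T₀ T₁ T₂ A₀ A₁ A₂)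
    (W := pc (wT₀ τ W₀) (wT₁ τ W₀ W₁) (wT₂ τ W₀ W₁ W₂)) (W₁ := lc (wT₁ τ W₀ W₁) (wT₂ τ W₀ W₁ W₂)) (W₂ := wT₂ τ W₀ W₁ W₂)
    (T := pc T₀ T₁ T₂) (A := pc A₀ A₁ A₂)
    (Eventually.of_forall fun u => hasDerivAt_Kc K₀ K₁ K₂ τ W₀ W₁ W₂ u) (hasDerivAt_Kc₁ K₀ K₁ K₂ τ W₀ W₁ W₂)
    (Eventually.of_forall fun u => hasDerivAt_Qc Q₀ Q₁ Q₂ τ W₀ W₁ W₂ u) (hasDerivAt_Qc₁ Q₀ Q₁ Q₂ τ W₀ W₁ W₂)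
    (Eventually.of_forall fun u => hasDerivAt_gc T₀ T₁ T₂ A₀ A₁ A₂ u) (hasDerivAt_gc₁ T₀ T₁ T₂ A₀ A₁ A₂)
    (Eventually.of_forall fun u => hasDerivAt_pc (wT₀ τ W₀) (wT₁ τ W₀ W₁) (wT₂ τ W₀ W₁ W₂) u)
    (hasDerivAt_lc (wT₁ τ W₀ W₁) (wT₂ τ W₀ W₁ W₂) 0)
    (Eventually.of_forall fun u => Kc_mul_wT K₀ K₁ K₂ τ W₀ W₁ W₂ hτ u)
    (Eventually.of_forall fun u => Kc_transpose_mul_wT K₀ K₁ K₂ τ W₀ W₁ W₂ hτ u)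
    (Eventually.of_forall fun u => Qc_mul_wT Q₀ Q₁ Q₂ τ W₀ W₁ W₂ hτ u)
    (Eventually.of_forall fun u => of_gc T₀ T₁ T₂ A₀ A₁ A₂ u) hTWev hAev hτW hM'
  rw [hK0, hK1, hK2, hQ0, hQ1, hQ2, of_gc_zero, of_gc₁_zero] at h
  simp only [of_pc_zero, of_lc_zero] at h
  rw [tau_wT₀ τ W₀ hτ, tau_wT₁ τ W₀ W₁ hτ, tau_wT₂ τ W₀ W₁ W₂ hτ, secondVar_one, mul_zero, add_zero] at h
  -- the identity in the re-parametrised gauge basis, read with the Gram jet names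
  have h' : secondVar (kkt K₀ (fromRows Q₀ τ)) (kkt K₁ (fromRows Q₁ (0 : Matrix ρ ν ℝ))) (kkt K₂ (fromRows Q₂ (0 : Matrix ρ ν ℝ)))
      + secondVar (gram₀ (wT₀ τ W₀) (gram₀ T₀ A₀)) (gram₁ (wT₀ τ W₀) (wT₁ τ W₀ W₁) (gram₀ T₀ A₀) (gram₁ T₀ T₁ A₀ A₁))
          (gram₂ (wT₀ τ W₀) (wT₁ τ W₀ W₁) (wT₂ τ W₀ W₁ W₂) (gram₀ T₀ A₀) (gram₁ T₀ T₁ A₀ A₁) (gram₂ T₀ T₁ T₂ A₀ A₁ A₂))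
    = secondVar (kkt (K₀ + gram₀ T₀ A₀) Q₀) (kkt (K₁ + gram₁ T₀ T₁ A₀ A₁) Q₁) (kkt (K₂ + gram₂ T₀ T₁ T₂ A₀ A₁ A₂) Q₂) := h
  -- back to the original gauge basis: `W̃ = W·S`, `S = (τW)⁻¹`-jets
  have eΦ : secondVar (gram₀ (wT₀ τ W₀) (gram₀ T₀ A₀)) (gram₁ (wT₀ τ W₀) (wT₁ τ W₀ W₁) (gram₀ T₀ A₀) (gram₁ T₀ T₁ A₀ A₁))
          (gram₂ (wT₀ τ W₀) (wT₁ τ W₀ W₁) (wT₂ τ W₀ W₁ W₂) (gram₀ T₀ A₀) (gram₁ T₀ T₁ A₀ A₁) (gram₂ T₀ T₁ T₂ A₀ A₁ A₂))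
      = secondVar (gram₀ W₀ (gram₀ T₀ A₀)) (gram₁ W₀ W₁ (gram₀ T₀ A₀) (gram₁ T₀ T₁ A₀ A₁))
          (gram₂ W₀ W₁ W₂ (gram₀ T₀ A₀) (gram₁ T₀ T₁ A₀ A₁) (gram₂ T₀ T₁ T₂ A₀ A₁ A₂))
        - 2 * secondVar (τ * W₀) (τ * W₁) (τ * W₂) := by
    have e0 : wT₀ τ W₀ = W₀ * sJ₀ τ W₀ := rfl
    have e1 : wT₁ τ W₀ W₁ = W₁ * sJ₀ τ W₀ + W₀ * sJ₁ τ W₀ W₁ := rfl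
    have e2 : wT₂ τ W₀ W₁ W₂ = W₂ * sJ₀ τ W₀ + (2 : ℝ) • (W₁ * sJ₁ τ W₀ W₁) + W₀ * sJ₂ τ W₀ W₁ W₂ := rfl
    rw [e0, e1, e2, gram₀_reparam, gram₁_reparam, gram₂_reparam, secondVar_sandwich _ _ _ _ _ _ hΦ0 hS0]
    have eS : secondVar (sJ₀ τ W₀) (sJ₁ τ W₀ W₁) (sJ₂ τ W₀ W₁ W₂) = -secondVar (τ * W₀) (τ * W₁) (τ * W₂) :=
      secondVar_inv_jets _ _ _ hτ
    rw [eS]; ring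
  rw [eΦ] at h'
  linarith

omit [DecidableEq ν] in
/-- [folklore] **THE GRAM SPLIT FROM BARE 2-JETS**: with `B_i := gram_i τ′ A`, `Φ_i := gram_i W B`:
`secondVar Φ = 2·secondVar (τ′W) + secondVar A` (`det(τ′₀W₀)`, `det A₀ ≠ 0`; no other hypothesis). -/
theorem secondVar_gram_split_jets (T₀ T₁ T₂ : Matrix ρ ν ℝ) (A₀ A₁ A₂ : Matrix ρ ρ ℝ) (W₀ W₁ W₂ : Matrix ν ρ ℝ)
    (hT : (T₀ * W₀).det ≠ 0) (hA : A₀.det ≠ 0) :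
    secondVar (gram₀ W₀ (gram₀ T₀ A₀)) (gram₁ W₀ W₁ (gram₀ T₀ A₀) (gram₁ T₀ T₁ A₀ A₁))
        (gram₂ W₀ W₁ W₂ (gram₀ T₀ A₀) (gram₁ T₀ T₁ A₀ A₁) (gram₂ T₀ T₁ T₂ A₀ A₁ A₂))
      = 2 * secondVar (T₀ * W₀) (T₁ * W₀ + T₀ * W₁) (T₂ * W₀ + T₁ * W₁ + (T₁ * W₁ + T₀ * W₂)) + secondVar A₀ A₁ A₂ := by
  have hT0 : (Matrix.of (pc T₀ T₁ T₂ 0) * Matrix.of (pc W₀ W₁ W₂ 0)).det ≠ 0 := by rw [of_pc_zero, of_pc_zero]; exact hT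
  have hA0 : (Matrix.of (pc A₀ A₁ A₂ 0)).det ≠ 0 := by rw [of_pc_zero]; exact hA
  have h := secondVar_gram_split
    (B := gc T₀ T₁ T₂ A₀ A₁ A₂) (B₁ := gc₁ T₀ T₁ T₂ A₀ A₁ A₂) (B₂ := gram₂ T₀ T₁ T₂ A₀ A₁ A₂)
    (W := pc W₀ W₁ W₂) (W₁ := lc W₁ W₂) (W₂ := W₂) (T := pc T₀ T₁ T₂) (T₁ := lc T₁ T₂) (T₂ := T₂)
    (A := pc A₀ A₁ A₂) (A₁ := lc A₁ A₂) (A₂ := A₂)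
    (Eventually.of_forall fun u => hasDerivAt_gc T₀ T₁ T₂ A₀ A₁ A₂ u) (hasDerivAt_gc₁ T₀ T₁ T₂ A₀ A₁ A₂)
    (Eventually.of_forall fun u => hasDerivAt_pc W₀ W₁ W₂ u) (hasDerivAt_lc W₁ W₂ 0)
    (Eventually.of_forall fun u => hasDerivAt_pc T₀ T₁ T₂ u) (hasDerivAt_lc T₁ T₂ 0)
    (Eventually.of_forall fun u => hasDerivAt_pc A₀ A₁ A₂ u) (hasDerivAt_lc A₁ A₂ 0)
    (Eventually.of_forall fun u => of_gc T₀ T₁ T₂ A₀ A₁ A₂ u) hT0 hA0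
  rw [of_gc_zero, of_gc₁_zero] at h
  simp only [of_pc_zero, of_lc_zero] at h
  exact h

end Main

end Summit.QuantumFields.BalabanUV.Beta.D1BFx.GramWeightJets

end
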